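import Literature.NumberTheory.GaloisRepresentations.HasseArfLayerNorm
import Literature.NumberTheory.GaloisRepresentations.ArtinConductorHerbrandProofs
import HarnessLib

/-!
# Hasse–Arf, tower step: the norm on the unit filtration of a cyclic totally ramified group (Serre V §6, Props. 8–9)

Third file of the completion-free proof of the Hasse–Arf theorem (after `HasseArfLayerTrace`,
`HasseArfLayerNorm`).  Global setting as before: `R` Dedekind with fraction field `K`, `L/K`
finite Galois with *abelian* group `G`, `S = integralClosure R L`, `𝔓 ≠ 0` a maximal ideal of
`S` with separable residue extension, and a *cyclic* subgroup `H ≤ G` contained in the inertia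
group `T_𝔓` (so `H = H_0`, and `L/L^H` is totally ramified at `𝔓`).  We write
`H_i = 𝔓.ramificationSubgroup H i`, `S_H(u) = Σ_{i=1}^{u} |H_i|` (`Literature.….ramificationCardSum`),
`N_H(y) = ∏_{h ∈ H} h y`, and use `S_H(u) = m |H|` as the integer form of `u = ψ_H(m)`
(Serre IV §3: `φ(u) + 1 = (1/g_0) Σ_{i=0}^{u} g_i`; `ψ(ℕ) ⊆ ℕ`).

The structure `Literature.….NormFiltration 𝔓 H` records the three consequences of Serre's
Props. V.8–9 that the Hasse–Arf argument (Ch. V §7) consumes, in this integer form and inside `S`: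

* `level` (**Prop. 8**): `N(U_L^{ψ(m)}) ⊆ U_K^m`, `N(U_L^{ψ(m)+1}) ⊆ U_K^{m+1}`, i.e.
  `y ∈ 𝔓^u ⇒ N_H(1+y) - 1 ∈ 𝔓^{m|H|}` and `y ∈ 𝔓^{u+1} ⇒ N_H(1+y) - 1 ∈ 𝔓^{(m+1)|H|}`;
* `inj` (**Prop. 9, Cor. 1** — injectivity of `N_m` when `H_{ψ(m)} = H_{ψ(m)+1}`);
* `surj` (**Prop. 9, Cor. 2 iii)/Cor. 3** in graded, approximate form — surjectivity of `N_m`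
  when `H_{ψ(m)} = 1`): every `H`-invariant `z ∈ 𝔓^{m|H|}` is `≡ N_H(1+y) - 1 mod 𝔓^{(m+1)|H|}`
  for some `y ∈ 𝔓^u`.

`Literature.….normFiltration` proves them for every such `(L, 𝔓, H)` by induction on `|H|`
(Serre's dévissage, Ch. V §6): a subgroup `Λ ≤ H_μ` of prime order `ℓ` (`μ` the last jump of
`H`) cuts `L ⊃ E = L^Λ ⊃ K`; the layer `L/E` is handled by `HasseArfLayerNorm` (its jump is `μ`),
the quotient `(E, 𝔓 ∩ E, H Λ/Λ)` by induction, and the two are glued by the transitivity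
`N_H = N_{H/Λ} ∘ N_Λ`, Herbrand's theorem `(H/Λ)_i = H_i Λ/Λ` for `i ≤ μ`, `(H/Λ)_i = 1` for
`i > μ` (tree: `map_ramificationSubgroup_eq_of_indexFormula`, `indexFormula_of_galoisQuotientData`)
and the resulting integer transitivity `ψ_H = ψ_Λ ∘ ψ_{H/Λ}`.

## References

* J.-P. Serre, *Local Fields*, GTM 67, Springer 1979: Ch. IV §3 Prop. 12–13, Lemma 5;
  Ch. V §6, Props. 8, 9 and Cor. 1–3 (pp. 91–93). [SerreLocalFields1979]
-/

open Polynomial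
open scoped Pointwise

noncomputable section

namespace Literature.NumberTheory.GaloisRepresentations

/-! ### `S_H(u) = Σ_{i=1}^u |H_i|` and the three norm properties -/

section Defs

variable {S : Type*} [CommRing S] (𝔓 : Ideal S) (Γ : Type*) [Group Γ] [MulSemiringAction Γ S]

/-- `S_Γ(u) = Σ_{i=1}^{u} |Γ_i|`, the numerator of Serre's `φ_Γ(u) = S_Γ(u)/|Γ_0|` at integers
(`φ(u) + 1 = (1/g_0) Σ_{i=0}^{u} g_i`); `S_Γ(u) = m |Γ_0|` is the integer form of
`u = ψ_Γ(m)`.  Ref: Serre, *Local Fields*, Ch. IV §3, Prop. 12 ff. (p. 73: the formula for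
`φ(m) + 1`). [cite: SerreLocalFields1979, Ch. IV §3 (p. 73)] -/
def ramificationCardSum (u : ℕ) : ℕ :=
  ∑ i ∈ Finset.Icc 1 u, Nat.card (𝔓.ramificationSubgroup Γ i)

/-- Unfolding lemma for `ramificationCardSum`. [folklore] -/
theorem ramificationCardSum_def (u : ℕ) :
    ramificationCardSum 𝔓 Γ u = ∑ i ∈ Finset.Icc 1 u, Nat.card (𝔓.ramificationSubgroup Γ i) :=
  rfl

/-- `S(0) = 0`. [folklore] -/
@[simp]
theorem ramificationCardSum_zero : ramificationCardSum 𝔓 Γ 0 = 0 := by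
  simp [ramificationCardSum]

/-- `S(u + 1) = S(u) + |Γ_{u+1}|`. [folklore] -/
theorem ramificationCardSum_succ (u : ℕ) :
    ramificationCardSum 𝔓 Γ (u + 1) = ramificationCardSum 𝔓 Γ u +
      Nat.card (𝔓.ramificationSubgroup Γ (u + 1)) := by
  rw [ramificationCardSum, ramificationCardSum, ← Finset.insert_Icc_right_eq_Icc_add_one
    (Nat.le_add_left 1 u), Finset.sum_insert (by simp), add_comm]

/-- `S` is strictly increasing (each `|Γ_i| ≥ 1`). [folklore] -/
theorem ramificationCardSum_lt_succ [Finite Γ] (u : ℕ) :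
    ramificationCardSum 𝔓 Γ u < ramificationCardSum 𝔓 Γ (u + 1) := by
  rw [ramificationCardSum_succ]
  exact Nat.lt_add_of_pos_right Nat.card_pos

/-- `S` is strictly monotone. [folklore] -/
theorem ramificationCardSum_strictMono [Finite Γ] : StrictMono (ramificationCardSum 𝔓 Γ) :=
  strictMono_nat_of_lt_succ (ramificationCardSum_lt_succ 𝔓 Γ)

/-- Beyond an index `μ` with `Γ_{μ+1} = 1`: `S(μ + k) = S(μ) + k`. [folklore] -/
theorem ramificationCardSum_add_of_eq_bot {μ : ℕ} (hμ : 𝔓.ramificationSubgroup Γ (μ + 1) = ⊥)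
    (k : ℕ) : ramificationCardSum 𝔓 Γ (μ + k) = ramificationCardSum 𝔓 Γ μ + k := by
  induction k with
  | zero => simp
  | succ k ih =>
    rw [← add_assoc, ramificationCardSum_succ, ih, add_assoc]
    congr 2
    have : 𝔓.ramificationSubgroup Γ (μ + k + 1) = ⊥ :=
      le_bot_iff.mp (hμ ▸ 𝔓.ramificationSubgroup_antitone Γ (by omega))
    rw [this, Subgroup.card_bot]

end Defs

section NormProps

variable {R : Type*} {K L : Type*} [CommRing R] [Field K] [Field L] [Algebra R K] [Algebra R L]
  [Algebra K L] [IsScalarTower R K L] [FiniteDimensional K L]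

open scoped Classical in
/-- **The three consequences of Serre's Props. V.8–9 used by the Hasse–Arf argument**, for a
subgroup `H` of `Gal(L/K)` at the maximal ideal `𝔓` of `S = integralClosure R L`, in integer form
(`S_H(u) = m|H|` ⟺ `u = ψ_H(m)`) and inside `S` (`N_H(y) = ∏_{h} h y`; "`∈ U_K^m`" for an
`H`-invariant principal unit is "`- 1 ∈ 𝔓^{m|H|}`"):
* `level`: `N(U_L^{ψ(m)}) ⊆ U_K^m` and `N(U_L^{ψ(m)+1}) ⊆ U_K^{m+1}` (Prop. 8);
* `inj`: if `H_{ψ(m)} = H_{ψ(m)+1}`, the graded map `N_m` is injective (Prop. 9 and Cor. 1);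
* `surj`: if `H_{ψ(m)} = 1`, the graded map `N_m` is surjective (Prop. 9 and Cor. 2 iii)).
Ref: Serre, *Local Fields*, Ch. V §6, Props. 8–9, Cor. 1–3 (pp. 91–93).
[cite: SerreLocalFields1979, Ch. V §6 Props. 8–9] -/
structure NormFiltration (𝔓 : Ideal (integralClosure R L)) (H : Subgroup (L ≃ₐ[K] L)) : Prop where
  /-- Prop. 8: `y ∈ 𝔓^{ψ(m)} ⇒ N(1+y) ∈ U_K^m` and `y ∈ 𝔓^{ψ(m)+1} ⇒ N(1+y) ∈ U_K^{m+1}`. -/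
  level : ∀ m u : ℕ, ramificationCardSum 𝔓 H u = m * Nat.card H →
    (∀ y ∈ 𝔓 ^ u, ∏ h : H, (1 + (h : L ≃ₐ[K] L) • y) - 1 ∈ 𝔓 ^ (m * Nat.card H)) ∧
    (∀ y ∈ 𝔓 ^ (u + 1), ∏ h : H, (1 + (h : L ≃ₐ[K] L) • y) - 1 ∈ 𝔓 ^ ((m + 1) * Nat.card H))
  /-- Prop. 9, Cor. 1: injectivity of `N_m` off the jumps. -/
  inj : ∀ m u : ℕ, ramificationCardSum 𝔓 H u = m * Nat.card H →
    𝔓.ramificationSubgroup H u = 𝔓.ramificationSubgroup H (u + 1) →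
    ∀ y ∈ 𝔓 ^ u, ∏ h : H, (1 + (h : L ≃ₐ[K] L) • y) - 1 ∈ 𝔓 ^ ((m + 1) * Nat.card H) →
      y ∈ 𝔓 ^ (u + 1)
  /-- Prop. 9, Cor. 2 iii): graded surjectivity of `N_m` above the last jump. -/
  surj : ∀ m u : ℕ, ramificationCardSum 𝔓 H u = m * Nat.card H →
    𝔓.ramificationSubgroup H u = ⊥ →
    ∀ z ∈ 𝔓 ^ (m * Nat.card H), (∀ h : H, (h : L ≃ₐ[K] L) • z = z) →
      ∃ y ∈ 𝔓 ^ u, ∏ h : H, (1 + (h : L ≃ₐ[K] L) • y) - 1 - z ∈ 𝔓 ^ ((m + 1) * Nat.card H)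

end NormProps

/-! ### Group-theoretic preliminaries -/

section GroupTheory

/-- Product over a finite group along a surjection: `∏_{a ∈ A} g(a) = ∏_{b ∈ B} ∏_{k ∈ ker f} g(s(b) k)`
for any section `s` of `f : A ↠ B` (the fibres of `f` are the cosets `s(b) ker f`). [folklore] -/
theorem prod_eq_prod_section_mul_ker {A B M : Type*} [Group A] [Group B] [CommMonoid M]
    [Fintype A] [Fintype B] (f : A →* B) (hf : Function.Surjective f) [Fintype f.ker]
    (g : A → M) :
    ∏ a, g a = ∏ b, ∏ k : f.ker, g (Function.surjInv hf b * k) := by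
  rw [← Fintype.prod_prod_type' (f := fun (b : B) (k : f.ker) => g (Function.surjInv hf b * k))]
  refine (Fintype.prod_bijective (fun bk : B × f.ker => Function.surjInv hf bk.1 * bk.2) ?_ _ _
    fun _ => rfl).symm
  constructor
  · rintro ⟨b₁, k₁⟩ ⟨b₂, k₂⟩ h
    have hb : b₁ = b₂ := by
      have h' := congrArg f h
      rw [map_mul, map_mul, Function.surjInv_eq hf, Function.surjInv_eq hf,
        (MonoidHom.mem_ker).mp k₁.2, (MonoidHom.mem_ker).mp k₂.2, mul_one, mul_one] at h'
      exact h'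
    subst hb
    have hk : (k₁ : A) = k₂ := mul_left_cancel h
    rw [Subtype.ext hk]
  · intro a
    refine ⟨⟨f a, ⟨(Function.surjInv hf (f a))⁻¹ * a, ?_⟩⟩, ?_⟩
    · rw [MonoidHom.mem_ker, map_mul, map_inv, Function.surjInv_eq hf, inv_mul_cancel]
    · simp only [mul_inv_cancel_left]

/-- A nontrivial finite group contains a (cyclic) subgroup of prime order, generated by an
element of prime order (Cauchy). [folklore] -/
theorem exists_prime_card_zpowers {A : Type*} [Group A] [Finite A] (h : Nat.card A ≠ 1) :
    ∃ (ℓ : ℕ) (a : A), ℓ.Prime ∧ Nat.card (Subgroup.zpowers a) = ℓ := by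
  obtain ⟨ℓ, hℓ, hdvd⟩ := Nat.exists_prime_and_dvd h
  haveI : Fact ℓ.Prime := ⟨hℓ⟩
  obtain ⟨a, ha⟩ := exists_prime_orderOf_dvd_card' (G := A) ℓ hdvd
  exact ⟨ℓ, a, hℓ, by rw [Nat.card_zpowers, ha]⟩

/-- A quotient of an abelian group is abelian (here: the target of a surjective homomorphism).
[folklore] -/
theorem isMulCommutative_of_surjective {A B : Type*} [Group A] [Group B] [IsMulCommutative A]
    (f : A →* B) (hf : Function.Surjective f) : IsMulCommutative B :=
  ⟨⟨fun x y => by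
    obtain ⟨a, rfl⟩ := hf x
    obtain ⟨b, rfl⟩ := hf y
    rw [← map_mul, ← map_mul, IsMulCommutative.is_comm.comm a b]⟩⟩

end GroupTheory

/-! ### The last jump of `H` and the layer subgroup `Λ` -/

section LastJump

variable {S : Type*} [CommRing S] (𝔓 : Ideal S) {G : Type*} [Group G] [MulSemiringAction G S]

/-- **The last jump.**  For a nontrivial finite group `Γ` acting faithfully on a Noetherian
domain with `Γ = Γ_0` (at a proper ideal `𝔓`), there is `μ` with `Γ_μ ≠ 1` and `Γ_{μ+1} = 1`
(the filtration starts at `Γ` and is eventually trivial, Serre IV §1 Prop. 1).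
Ref: Serre, *Local Fields*, Ch. IV §1, Prop. 1; Ch. V §7 ("let `μ` be the largest integer such
that `G_μ ≠ {1}`"). [cite: SerreLocalFields1979, Ch. IV §1 Prop. 1] -/
theorem exists_last_jump [IsDomain S] [IsNoetherianRing S] (Γ : Subgroup G) [Finite Γ]
    [FaithfulSMul Γ S] (h𝔓 : 𝔓 ≠ ⊤) (h0 : 𝔓.ramificationSubgroup Γ 0 = ⊤)
    (hne : Nat.card Γ ≠ 1) :
    ∃ μ : ℕ, 𝔓.ramificationSubgroup Γ μ ≠ ⊥ ∧ 𝔓.ramificationSubgroup Γ (μ + 1) = ⊥ := by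
  classical
  obtain ⟨N, hN⟩ := Ideal.ramificationSubgroup_eventually_eq_bot_holds 𝔓 Γ h𝔓
  have hex : ∃ k, 𝔓.ramificationSubgroup Γ (k + 1) = ⊥ := ⟨N, hN _ (Nat.le_succ N)⟩
  refine ⟨Nat.find hex, ?_, Nat.find_spec hex⟩
  intro hbot
  rcases Nat.eq_zero_or_eq_succ_pred (Nat.find hex) with h | h
  · rw [h, h0] at hbot
    exact hne (by rw [← Subgroup.card_top (G := Γ), hbot, Subgroup.card_bot])
  · refine Nat.find_min hex (Nat.pred_lt (by omega)) ?_
    have h' : (Nat.find hex).pred + 1 = Nat.find hex := by omega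
    rw [h']
    exact hbot

end LastJump

/-! ### Herbrand's theorem for the last layer `Λ ≤ H_μ`: `|(H/Λ)_i| ℓ = |H_i|` (`i ≤ μ`), `(H/Λ)_i = 1` (`i > μ`) -/

section HerbrandLastLayer

variable (R : Type*) {K L : Type*} [CommRing R] [Field K] [Field L] [Algebra R K] [Algebra R L]
  [Algebra K L] [IsScalarTower R K L]

attribute [local instance] integralClosureAlgebra integralClosure_isScalarTower_left
  integralClosure_isScalarTower_bot integralClosure_faithfulSMul integralClosure_isIntegral
  integralClosure_isTorsionFree isMaximal_under_integralClosure under_integralClosure_liesOver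
  residueAlgebra residueSMul isScalarTower_residue

variable (E : IntermediateField K L) [IsDedekindDomain R] [IsFractionRing R K]
  [FiniteDimensional K L] [IsGalois K L]
  (𝔓 : Ideal (integralClosure R L)) [𝔓.IsMaximal]

set_option maxHeartbeats 1600000 in
/-- **Herbrand's theorem for the last layer.**  Let `H ≤ T_𝔓` (a subgroup of `G = Gal(L/K)`
contained in the inertia group of `𝔓`), `E/K` a normal subextension with
`Λ = Gal(L/E) ≤ H`, `Λ ⊆ G_μ` and `H_{μ+1} = 1` (so `μ` is the jump of `Λ` and the last jump of
`H`).  Let `π = res_E` and `H' = π(H) ≤ Gal(E/K)`, with its filtration at `𝔓 ∩ E`.  Then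
`|H'_i| |Λ| = |H_i|` for `i ≤ μ` (`H'_i = π(H_i)`, `Λ ⊆ H_i`) and `H'_i = 1` for `i > μ`.
Proof: the index formula for the Galois quotient data `(S_L, S_E, H, H', π, ι)`
(`indexFormula_of_galoisQuotientData`, with `e(𝔓|𝔓 ∩ E) = |Λ|` by total ramification), hence
Herbrand's Lemma 5 `π(H_u) = H'_{φ_Λ(u)}` (`map_ramificationSubgroup_eq_of_indexFormula`), and
`φ_Λ(u) = u` for `u ≤ μ`, `ψ_Λ(i) > μ` for `i > μ`.
Ref: Serre, *Local Fields*, Ch. IV §3, Lemma 5 (Herbrand) and Prop. 3; Ch. V §6, proof of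
Prop. 9 (`d = (G_{ψ(n)} : G_{ψ(n)+1})`). [cite: SerreLocalFields1979, Ch. IV §3 Lemma 5 (p. 75)] -/
theorem card_ramificationSubgroup_map_restrictNormalHom [Normal K E] (h𝔓 : 𝔓 ≠ ⊥)
    [Algebra.IsSeparable (R ⧸ 𝔓.under R) (integralClosure R L ⧸ 𝔓)]
    (H : Subgroup (L ≃ₐ[K] L)) (hH : H ≤ 𝔓.inertia (L ≃ₐ[K] L))
    (hΛH : E.fixingSubgroup ≤ H) {μ : ℕ}
    (hμ : ∀ γ ∈ E.fixingSubgroup, γ ∈ 𝔓.ramificationSubgroup (L ≃ₐ[K] L) μ)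
    (hμ1 : 𝔓.ramificationSubgroup H (μ + 1) = ⊥) :
    (∀ i ≤ μ, Nat.card ((𝔓.comap (E.integralClosureInclusion R)).ramificationSubgroup
        (H.map (AlgEquiv.restrictNormalHom E)) i) * Nat.card E.fixingSubgroup =
        Nat.card (𝔓.ramificationSubgroup H i)) ∧
    (∀ i, μ < i → (𝔓.comap (E.integralClosureInclusion R)).ramificationSubgroup
        (H.map (AlgEquiv.restrictNormalHom E)) i = ⊥) := by
  classical
  -- the data
  haveI : FaithfulSMul (L ≃ₐ[K] L) (integralClosure R L) := faithfulSMul_algEquiv_integralClosure R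
  haveI : FaithfulSMul (E ≃ₐ[K] E) (integralClosure R E) := faithfulSMul_algEquiv_integralClosure R
  haveI : IsDedekindDomain (integralClosure R L) := integralClosure.isDedekindDomain R K L
  haveI : IsDedekindDomain (integralClosure R E) := integralClosure.isDedekindDomain R K E
  haveI : Module.Finite R (integralClosure R L) :=
    IsIntegralClosure.finite R K L (integralClosure R L)
  haveI hGalE : IsGaloisGroup E.fixingSubgroup (integralClosure R E) (integralClosure R L) :=
    isGaloisGroup_fixingSubgroup_integralClosure R E
  haveI : Algebra.IsInvariant (integralClosure R E) (integralClosure R L) E.fixingSubgroup :=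
    hGalE.isInvariant
  haveI h𝔓prime : 𝔓.IsPrime := Ideal.IsMaximal.isPrime inferInstance
  set π : (L ≃ₐ[K] L) →* (E ≃ₐ[K] E) := AlgEquiv.restrictNormalHom E with hπdef
  set H' : Subgroup (E ≃ₐ[K] E) := H.map π with hH'def
  set πH : H →* H' := π.subgroupMap H with hπHdef
  have hπH : ∀ h : H, ((πH h : H') : E ≃ₐ[K] E) = π h := fun h => rfl
  have hπHsurj : Function.Surjective πH := π.subgroupMap_surjective H
  set ι : integralClosure R E →+* integralClosure R L := (E.integralClosureInclusion R).toRingHom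
    with hιdef
  have hι : Function.Injective ι := E.integralClosureInclusion_injective R
  have hequiv : ∀ (g : H) (t : integralClosure R E), ι (πH g • t) = g • ι t := fun g t =>
    E.integralClosureInclusion_restrictNormalHom_smul R g t
  have hkerπ : π.ker = E.fixingSubgroup := IntermediateField.restrictNormalHom_ker E
  have hkerH : ∀ k : H, k ∈ πH.ker ↔ (k : L ≃ₐ[K] L) ∈ E.fixingSubgroup := fun k => by
    rw [MonoidHom.mem_ker, ← hkerπ, MonoidHom.mem_ker, ← hπH, OneMemClass.coe_eq_one]
  have hfix : ∀ a : integralClosure R L, (∀ h : πH.ker, (h : H) • a = a) → a ∈ Set.range ι := by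
    intro a ha
    obtain ⟨w, hw⟩ := Algebra.IsInvariant.isInvariant (A := integralClosure R E)
      (G := E.fixingSubgroup) a fun γ => ha ⟨⟨γ, hΛH γ.2⟩, (hkerH _).mpr γ.2⟩
    exact ⟨w, hw⟩
  -- `ker πH ≅ Λ`
  have hkercard : Nat.card πH.ker = Nat.card E.fixingSubgroup :=
    Nat.card_congr
      { toFun := fun k => ⟨((k : H) : L ≃ₐ[K] L), (hkerH k).mp k.2⟩
        invFun := fun γ => ⟨⟨γ, hΛH γ.2⟩, (hkerH _).mpr γ.2⟩
        left_inv := fun k => rfl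
        right_inv := fun γ => rfl }
  -- every element of `H`, `H'`, `ker πH` lies in the respective inertia group
  have hH0 : 𝔓.ramificationSubgroup H 0 = ⊤ := by
    refine eq_top_iff.mpr fun h _ => ?_
    rw [Ideal.ramificationSubgroup_zero]
    exact (AddSubgroup.mem_inertia (I := 𝔓.toAddSubgroup)).mpr fun z =>
      (AddSubgroup.mem_inertia (I := 𝔓.toAddSubgroup)).mp (hH h.2) z
  set 𝔓E := 𝔓.comap (E.integralClosureInclusion R) with h𝔓Edef
  have h𝔓Eι : 𝔓.comap ι = 𝔓E := rfl
  have hH'0 : 𝔓E.ramificationSubgroup H' 0 = ⊤ := by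
    refine eq_top_iff.mpr fun h' _ => ?_
    rw [Ideal.ramificationSubgroup_zero]
    obtain ⟨h, rfl⟩ := hπHsurj h'
    refine (AddSubgroup.mem_inertia (I := 𝔓E.toAddSubgroup)).mpr fun z => ?_
    change ι (πH h • z - z) ∈ 𝔓
    rw [map_sub, hequiv]
    exact (AddSubgroup.mem_inertia (I := 𝔓.toAddSubgroup)).mp (hH h.2) (ι z)
  have hker0 : ∀ i ≤ μ, 𝔓.ramificationSubgroup πH.ker i = ⊤ := by
    intro i hi
    refine eq_top_iff.mpr fun k _ => ?_
    exact 𝔓.ramificationSubgroup_antitone _ hi (hμ _ ((hkerH _).mp k.2))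
  -- hypotheses of Herbrand's Lemma 5 for `πH`
  have hI : (𝔓.ramificationSubgroup H 0).map πH = 𝔓E.ramificationSubgroup H' 0 := by
    rw [hH0, hH'0, Subgroup.map_top_of_surjective _ hπHsurj]
  haveI : SMulCommClass H R (integralClosure R L) :=
    ⟨fun h r z => smul_comm (h : L ≃ₐ[K] L) r z⟩
  haveI : Fintype E.fixingSubgroup := Fintype.ofFinite _
  have hmap := map_under_eq_pow_card R E 𝔓 h𝔓 (hΛH.trans hH)
  have h3 : IndexFormula 𝔓 𝔓E πH := by
    rw [← h𝔓Eι]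
    refine indexFormula_of_galoisQuotientData 𝔓 πH ι hι hequiv hfix R (fun _ => inferInstance)
      fun _ => ?_
    have hmap' : (𝔓.comap ι).map ι = 𝔓 ^ Fintype.card E.fixingSubgroup := hmap
    rw [hmap', emultiplicity_pow_self h𝔓 (fun hu => Ideal.IsPrime.ne_top inferInstance
      (Ideal.isUnit_iff.mp hu)), ← Nat.card_eq_fintype_card, ← hkercard]
    congr 1
    have htop : 𝔓.inertia πH.ker = ⊤ := by
      rw [← Ideal.ramificationSubgroup_zero]
      exact hker0 0 (Nat.zero_le μ)
    rw [htop, Subgroup.card_top]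
  have hL5 := map_ramificationSubgroup_eq_of_indexFormula 𝔓 𝔓E πH hI hμ1 h3
  -- `φ_Λ(m) = m` for `m ≤ μ`
  have hphi : ∀ m ≤ μ, herbrandPhi 𝔓 πH.ker m = m := by
    intro m hm
    have h := card_mul_herbrandPhi_natCast_add_one 𝔓 (G := πH.ker) m
    have hterm : ∀ i ∈ Finset.range (m + 1),
        (Nat.card (𝔓.ramificationSubgroup πH.ker i) : ℝ) = Nat.card πH.ker := by
      intro i hi
      rw [hker0 i ((Nat.lt_succ_iff.mp (Finset.mem_range.mp hi)).trans hm), Subgroup.card_top]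
    rw [Finset.sum_congr rfl hterm, Finset.sum_const, Finset.card_range, nsmul_eq_mul,
      hker0 0 (Nat.zero_le μ), Subgroup.card_top] at h
    have hc : (0 : ℝ) < Nat.card πH.ker := by exact_mod_cast Nat.card_pos
    have key : (Nat.card πH.ker : ℝ) * (herbrandPhi 𝔓 πH.ker m + 1) =
        (Nat.card πH.ker : ℝ) * (m + 1) := by
      rw [h]; push_cast; ring
    have := mul_left_cancel₀ hc.ne' key
    linarith
  refine ⟨fun i hi => ?_, fun i hi => ?_⟩
  · -- `i ≤ μ`: `π(H_i) = H'_i` and `|π(H_i)| |Λ| = |H_i|`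
    have h := hL5 i
    rw [Nat.ceil_natCast, hphi i hi, Nat.ceil_natCast] at h
    have hcard := card_map_mul_card_ramificationSubgroup_ker 𝔓 πH i
    rw [h, hker0 i hi, Subgroup.card_top, hkercard] at hcard
    exact hcard
  · -- `i > μ`: `H'_i = π(H_{⌈ψ i⌉}) = 1`
    have h := hL5 (herbrandPsi 𝔓 πH.ker i)
    rw [herbrandPhi_herbrandPsi_holds 𝔓 πH.ker (i : ℝ), Nat.ceil_natCast] at h
    rw [← h]
    have hψμ : herbrandPsi 𝔓 πH.ker μ = μ := by
      conv_lhs => rw [← hphi μ le_rfl]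
      exact herbrandPsi_herbrandPhi_holds 𝔓 πH.ker (μ : ℝ)
    have hlt : (μ : ℝ) < herbrandPsi 𝔓 πH.ker i := by
      rw [← hψμ]
      exact herbrandPsi_strictMono 𝔓 πH.ker (by exact_mod_cast hi)
    have hle : μ + 1 ≤ ⌈herbrandPsi 𝔓 πH.ker i⌉₊ := Nat.add_one_le_iff.mpr (Nat.lt_ceil.mpr hlt)
    have hbot : 𝔓.ramificationSubgroup H ⌈herbrandPsi 𝔓 πH.ker i⌉₊ = ⊥ :=
      le_bot_iff.mp (hμ1 ▸ 𝔓.ramificationSubgroup_antitone H hle)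
    rw [hbot, Subgroup.map_bot]

end HerbrandLastLayer

/-! ### Transitivity of the norm: `N_H = N_{H/Λ} ∘ N_Λ` -/

section NormTransitivity

variable (R : Type*) {K L : Type*} [CommRing R] [Field K] [Field L] [Algebra R K] [Algebra R L]
  [Algebra K L] [IsScalarTower R K L]

attribute [local instance] integralClosureAlgebra integralClosure_isScalarTower_left
  integralClosure_isScalarTower_bot integralClosure_faithfulSMul integralClosure_isIntegral
  integralClosure_isTorsionFree isMaximal_under_integralClosure under_integralClosure_liesOver
  residueAlgebra residueSMul isScalarTower_residue

variable (E : IntermediateField K L) [IsDedekindDomain R] [IsFractionRing R K]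
  [FiniteDimensional K L] [IsGalois K L]

/-- **Transitivity of the norm along `L ⊃ E ⊃ K`**, inside `S`: for `Λ = Gal(L/E) ≤ H ≤ Gal(L/K)`
(`E/K` normal), `N_Λ(y) = ∏_{γ ∈ Λ} γ y ∈ S_E` and `N_H(y) = N_{H'}(N_Λ(y))` with
`H' = res_E(H) ≤ Gal(E/K)` (the fibres of `res_E : H ↠ H'` are the cosets of `Λ`).
Ref: Serre, *Local Fields*, Ch. V §6, proof of Prop. 8 (`N_{L/K} = N_{K'/K} ∘ N_{L/K'}`);
Bourbaki, *Alg.* V (transitivity of the norm). [cite: SerreLocalFields1979, Ch. V §6 Prop. 8 (proof)] -/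
theorem exists_prod_smul_eq_algebraMap_prod [Normal K E] (H : Subgroup (L ≃ₐ[K] L))
    (hΛH : E.fixingSubgroup ≤ H) [Fintype H] [Fintype E.fixingSubgroup]
    [Fintype (H.map (AlgEquiv.restrictNormalHom E))] (y : integralClosure R L) :
    ∃ w : integralClosure R E,
      algebraMap (integralClosure R E) (integralClosure R L) w =
        ∏ γ : E.fixingSubgroup, (γ : L ≃ₐ[K] L) • y ∧
      ∏ h : H, (h : L ≃ₐ[K] L) • y = algebraMap (integralClosure R E) (integralClosure R L)
        (∏ h' : H.map (AlgEquiv.restrictNormalHom E), (h' : E ≃ₐ[K] E) • w) := by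
  classical
  haveI : FaithfulSMul (L ≃ₐ[K] L) (integralClosure R L) := faithfulSMul_algEquiv_integralClosure R
  haveI hGalE : IsGaloisGroup E.fixingSubgroup (integralClosure R E) (integralClosure R L) :=
    isGaloisGroup_fixingSubgroup_integralClosure R E
  haveI : Algebra.IsInvariant (integralClosure R E) (integralClosure R L) E.fixingSubgroup :=
    hGalE.isInvariant
  -- `N_Λ(y) ∈ S_E`
  obtain ⟨w, hw⟩ : ∃ w : integralClosure R E, algebraMap (integralClosure R E) (integralClosure R L) w =
      ∏ γ : E.fixingSubgroup, (γ : L ≃ₐ[K] L) • y := by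
    refine Algebra.IsInvariant.isInvariant (A := integralClosure R E) (G := E.fixingSubgroup) _
      fun g => ?_
    rw [Finset.smul_prod']
    exact Fintype.prod_bijective (g * ·) (Group.mulLeft_bijective g) _ _ fun h => by
      rw [Subgroup.coe_mul, mul_smul]; rfl
  refine ⟨w, hw, ?_⟩
  -- the surjection `πH : H → H'` with kernel `≅ Λ`
  set πH : H →* H.map (AlgEquiv.restrictNormalHom E) := (AlgEquiv.restrictNormalHom E).subgroupMap H
    with hπHdef
  have hπH : ∀ h : H, ((πH h : H.map (AlgEquiv.restrictNormalHom E)) : E ≃ₐ[K] E) =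
      AlgEquiv.restrictNormalHom E (h : L ≃ₐ[K] L) := fun h => rfl
  have hπHsurj : Function.Surjective πH := (AlgEquiv.restrictNormalHom E).subgroupMap_surjective H
  have hkerH : ∀ k : H, k ∈ πH.ker ↔ (k : L ≃ₐ[K] L) ∈ E.fixingSubgroup := fun k => by
    rw [MonoidHom.mem_ker, ← IntermediateField.restrictNormalHom_ker E, MonoidHom.mem_ker, ← hπH,
      OneMemClass.coe_eq_one]
  let e : πH.ker ≃ E.fixingSubgroup :=
    { toFun := fun k => ⟨((k : H) : L ≃ₐ[K] L), (hkerH k).mp k.2⟩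
      invFun := fun γ => ⟨⟨γ, hΛH γ.2⟩, (hkerH _).mpr γ.2⟩
      left_inv := fun k => rfl
      right_inv := fun γ => rfl }
  have hker_prod : ∀ z : integralClosure R L,
      ∏ k : πH.ker, (((k : H) : L ≃ₐ[K] L)) • z = ∏ γ : E.fixingSubgroup, (γ : L ≃ₐ[K] L) • z :=
    fun z => Fintype.prod_equiv e _ _ fun k => rfl
  -- decompose the product over `H` along `πH`
  rw [prod_eq_prod_section_mul_ker πH hπHsurj (fun h : H => (h : L ≃ₐ[K] L) • y), map_prod]
  refine Finset.prod_congr rfl fun h' _ => ?_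
  set s := Function.surjInv hπHsurj h' with hs
  have hinner : ∏ k : πH.ker, (((s * (k : H) : H) : L ≃ₐ[K] L)) • y =
      ((s : H) : L ≃ₐ[K] L) • ∏ k : πH.ker, (((k : H) : L ≃ₐ[K] L)) • y := by
    rw [Finset.smul_prod']
    refine Finset.prod_congr rfl fun k _ => ?_
    rw [Subgroup.coe_mul, mul_smul]
  rw [hinner, hker_prod, ← hw]
  -- `(s : G) • ι w = ι (res_E(s) • w) = ι (h' • w)`
  have h1 := (E.integralClosureInclusion_restrictNormalHom_smul R ((s : H) : L ≃ₐ[K] L) w).symm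
  have h2 : AlgEquiv.restrictNormalHom E ((s : H) : L ≃ₐ[K] L) =
      ((h' : H.map (AlgEquiv.restrictNormalHom E)) : E ≃ₐ[K] E) := by
    rw [← hπH, hs, Function.surjInv_eq hπHsurj]
  rw [h2] at h1
  exact h1

end NormTransitivity

/-! ### Small helpers: perturbation of products, `S_F`-membership transfer -/

section Helpers

/-- **Perturbation of a product.**  If `f i ≡ g i (mod I)` for all `i`, then
`∏ f i ≡ ∏ g i (mod I)`.  (Used with arbitrarily deep `I = 𝔓^B`: the completion-free substitute
for passing to a limit.) [folklore] -/
theorem prod_sub_prod_mem {ι S : Type*} [CommRing S] (I : Ideal S) (s : Finset ι) (f g : ι → S)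
    (h : ∀ i ∈ s, f i - g i ∈ I) : ∏ i ∈ s, f i - ∏ i ∈ s, g i ∈ I := by
  classical
  induction s using Finset.induction_on with
  | empty => simp
  | insert a s ha ih =>
    rw [Finset.prod_insert ha, Finset.prod_insert ha,
      show f a * ∏ i ∈ s, f i - g a * ∏ i ∈ s, g i =
        f a * (∏ i ∈ s, f i - ∏ i ∈ s, g i) + (f a - g a) * ∏ i ∈ s, g i by ring]
    exact I.add_mem (I.mul_mem_left _ (ih fun i hi => h i (Finset.mem_insert_of_mem hi)))
      (I.mul_mem_right _ (h a (Finset.mem_insert_self a s)))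

variable (R : Type*) {K L : Type*} [CommRing R] [Field K] [Field L] [Algebra R K] [Algebra R L]
  [Algebra K L] [IsScalarTower R K L]

attribute [local instance] integralClosureAlgebra integralClosure_isScalarTower_left
  integralClosure_isScalarTower_bot integralClosure_faithfulSMul integralClosure_isIntegral
  integralClosure_isTorsionFree isMaximal_under_integralClosure under_integralClosure_liesOver
  residueAlgebra residueSMul isScalarTower_residue

variable (F : IntermediateField K L) [IsDedekindDomain R] [IsFractionRing R K]
  [FiniteDimensional K L] [IsGalois K L]
  (𝔓 : Ideal (integralClosure R L)) [𝔓.IsMaximal]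

/-- From `z₀ ∈ 𝔓_F ^ k` to `ι(z₀) ∈ 𝔓 ^ (|Γ| k)` (total ramification, `𝔓_F S = 𝔓^{|Γ|}`).
Ref: Serre, *Local Fields*, Ch. I §4 (`v_𝔓 = e v_𝔭` on `K`). [folklore] -/
theorem algebraMap_mem_pow_of_mem_under_pow [Fintype F.fixingSubgroup] (h𝔓 : 𝔓 ≠ ⊥)
    [Algebra.IsSeparable (R ⧸ 𝔓.under R) (integralClosure R L ⧸ 𝔓)]
    (hF : F.fixingSubgroup ≤ 𝔓.inertia (L ≃ₐ[K] L)) {z₀ : integralClosure R F} {k : ℕ}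
    (hz : z₀ ∈ 𝔓.under (integralClosure R F) ^ k) :
    algebraMap (integralClosure R F) (integralClosure R L) z₀ ∈
      𝔓 ^ (Fintype.card F.fixingSubgroup * k) := by
  have h := Ideal.mem_map_of_mem (algebraMap (integralClosure R F) (integralClosure R L)) hz
  rwa [Ideal.map_pow, map_under_eq_pow_card R F 𝔓 h𝔓 hF, ← pow_mul] at h

end Helpers

/-! ### The induction step: gluing the layer `L/E` and the quotient `E/K` -/

section Step

variable (R : Type*) {K L : Type*} [CommRing R] [Field K] [Field L] [Algebra R K] [Algebra R L]
  [Algebra K L] [IsScalarTower R K L]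

attribute [local instance] integralClosureAlgebra integralClosure_isScalarTower_left
  integralClosure_isScalarTower_bot integralClosure_faithfulSMul integralClosure_isIntegral
  integralClosure_isTorsionFree isMaximal_under_integralClosure under_integralClosure_liesOver
  residueAlgebra residueSMul isScalarTower_residue

variable (E : IntermediateField K L) [IsDedekindDomain R] [IsFractionRing R K]
  [FiniteDimensional K L] [IsGalois K L]
  (𝔓 : Ideal (integralClosure R L)) [𝔓.IsMaximal]

set_option maxHeartbeats 3200000 in
/-- **Serre V §6, Props. 8–9: the induction step.**  Let `H ≤ T_𝔓`, `E/K` Galois with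
`Λ = Gal(L/E) ≤ H` of prime order `ℓ`, `Λ ⊆ G_μ`, `H_{μ+1} = 1` (so `L/E` is a cyclic layer of
degree `ℓ` with jump `μ`, the last jump of `H`).  If the three norm properties hold for the
quotient `(E, 𝔓 ∩ E, H' = res_E(H))`, they hold for `(L, 𝔓, H)`.  Proof: for `S_H(u) = m|H|`
there is `j` with `u = ψ_Λ(j) = min(j,μ) + ℓ(j-μ)` and `S_{H'}(j) = m|H'|` (Herbrand:
`|H'_i| ℓ = |H_i|` for `i ≤ μ`, `H'_i = 1` for `i > μ`; this is `ψ_H = ψ_Λ ∘ ψ_{H'}` at integers),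
with `j ≠ μ` and `H'_j = H'_{j+1}` when `H_u = H_{u+1}`, and `j > μ`, `H'_j = 1` when `H_u = 1`;
then `N_H = N_{H'} ∘ N_Λ` (`exists_prod_smul_eq_algebraMap_prod`) and the layer statements of
`HasseArfLayerNorm` compose with the hypotheses on `H'`.
Ref: Serre, *Local Fields*, Ch. V §6, proof of Props. 8 and 9 (pp. 91–92).
[cite: SerreLocalFields1979, Ch. V §6 Props. 8–9] -/
theorem normFiltration_step [Normal K E] (h𝔓 : 𝔓 ≠ ⊥)
    [Algebra.IsSeparable (R ⧸ 𝔓.under R) (integralClosure R L ⧸ 𝔓)]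
    (H : Subgroup (L ≃ₐ[K] L)) (hH : H ≤ 𝔓.inertia (L ≃ₐ[K] L))
    (hFH : E.fixingSubgroup ≤ H) {ℓ : ℕ} (hℓ : ℓ.Prime) (hFcard : Nat.card E.fixingSubgroup = ℓ)
    {μ : ℕ} (hFμ : ∀ γ ∈ E.fixingSubgroup, γ ∈ 𝔓.ramificationSubgroup (L ≃ₐ[K] L) μ)
    (hμ1 : 𝔓.ramificationSubgroup H (μ + 1) = ⊥)
    (hIH : NormFiltration (𝔓.comap (E.integralClosureInclusion R))
      (H.map (AlgEquiv.restrictNormalHom E))) :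
    NormFiltration 𝔓 H := by
  classical
  ------------------------------------------------------------------
  -- instances and basic facts
  ------------------------------------------------------------------
  haveI : FaithfulSMul (L ≃ₐ[K] L) (integralClosure R L) := faithfulSMul_algEquiv_integralClosure R
  haveI : IsDedekindDomain (integralClosure R L) := integralClosure.isDedekindDomain R K L
  haveI : IsDedekindDomain (integralClosure R E) := integralClosure.isDedekindDomain R K E
  haveI hGalE : IsGaloisGroup E.fixingSubgroup (integralClosure R E) (integralClosure R L) :=
    isGaloisGroup_fixingSubgroup_integralClosure R E
  haveI : Algebra.IsInvariant (integralClosure R E) (integralClosure R L) E.fixingSubgroup :=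
    hGalE.isInvariant
  haveI h𝔓prime : 𝔓.IsPrime := Ideal.IsMaximal.isPrime inferInstance
  have hstabH : ∀ h : H, (h : L ≃ₐ[K] L) • 𝔓 = 𝔓 := fun h =>
    (Ideal.inertia_le_stabilizer 𝔓) (hH h.2)
  have hF : E.fixingSubgroup ≤ 𝔓.inertia (L ≃ₐ[K] L) := hFH.trans hH
  have hℓ2 : 2 ≤ ℓ := hℓ.two_le
  have hℓpos : 0 < ℓ := by omega
  have hFc : Fintype.card E.fixingSubgroup = ℓ := by rw [← Nat.card_eq_fintype_card, hFcard]
  have hFprime : (Fintype.card E.fixingSubgroup).Prime := by rw [hFc]; exact hℓ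
  have ht : ∀ γ : E.fixingSubgroup, (γ : L ≃ₐ[K] L) ∈ 𝔓.ramificationSubgroup (L ≃ₐ[K] L) μ :=
    fun γ => hFμ γ γ.2
  have ht1 : ∀ γ : E.fixingSubgroup, γ ≠ 1 →
      (γ : L ≃ₐ[K] L) ∉ 𝔓.ramificationSubgroup (L ≃ₐ[K] L) (μ + 1) := by
    intro γ hne hmem
    have h : (⟨(γ : L ≃ₐ[K] L), hFH γ.2⟩ : H) ∈ 𝔓.ramificationSubgroup H (μ + 1) := hmem
    rw [hμ1, Subgroup.mem_bot] at h
    have h' : ((γ : L ≃ₐ[K] L)) = 1 := congrArg (fun x : H => (x : L ≃ₐ[K] L)) h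
    exact hne (Subtype.ext h')
  -- `Λ` is nontrivial inside `H_μ`, so `H_μ ≠ H_{μ+1}` and `H_u ≠ 1` for `u ≤ μ`
  have hHμ_ne : ∀ u ≤ μ, 𝔓.ramificationSubgroup H u ≠ ⊥ := by
    intro u hu hbot
    have h1 : Nat.card E.fixingSubgroup ≤ 1 := by
      rw [← Subgroup.card_bot (G := H), ← hbot]
      refine Nat.card_le_card_of_injective
        (fun γ : E.fixingSubgroup => (⟨⟨γ, hFH γ.2⟩,
          𝔓.ramificationSubgroup_antitone _ hu (ht γ)⟩ : 𝔓.ramificationSubgroup H u)) ?_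
      intro a b h
      have h' := congrArg (fun x : 𝔓.ramificationSubgroup H u => ((x : H) : L ≃ₐ[K] L)) h
      exact Subtype.ext h'
    rw [hFcard] at h1
    omega
  ------------------------------------------------------------------
  -- notation for the quotient data; Herbrand's theorem for the last layer
  ------------------------------------------------------------------
  set 𝔓E : Ideal (integralClosure R E) := 𝔓.comap (E.integralClosureInclusion R) with h𝔓Edef
  have h𝔓Eunder : 𝔓E = 𝔓.under (integralClosure R E) := rfl
  set H' : Subgroup (E ≃ₐ[K] E) := H.map (AlgEquiv.restrictNormalHom E) with hH'def
  obtain ⟨hcards, hbots⟩ :=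
    card_ramificationSubgroup_map_restrictNormalHom R E 𝔓 h𝔓 H hH hFH (μ := μ) hFμ hμ1
  have hsurjπ : Function.Surjective ((AlgEquiv.restrictNormalHom E).subgroupMap H) :=
    (AlgEquiv.restrictNormalHom E).subgroupMap_surjective H
  have hπcoe : ∀ h : H, (((AlgEquiv.restrictNormalHom E).subgroupMap H h : H') : E ≃ₐ[K] E) =
      AlgEquiv.restrictNormalHom E (h : L ≃ₐ[K] L) := fun h => rfl
  have hH'inertia : ∀ h' : H', h' ∈ 𝔓E.inertia H' := by
    intro h'
    obtain ⟨h, rfl⟩ := hsurjπ h'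
    refine (AddSubgroup.mem_inertia (I := 𝔓E.toAddSubgroup)).mpr fun z => ?_
    change E.integralClosureInclusion R ((AlgEquiv.restrictNormalHom E (h : L ≃ₐ[K] L)) • z - z) ∈ 𝔓
    rw [map_sub, E.integralClosureInclusion_restrictNormalHom_smul R]
    exact (AddSubgroup.mem_inertia (I := 𝔓.toAddSubgroup)).mp (hH h.2) _
  have hstabH' : ∀ h' : H', h' • 𝔓E = 𝔓E := fun h' =>
    (Ideal.inertia_le_stabilizer (M := H') 𝔓E) (hH'inertia h')
  -- `|H| = |H'| ℓ`
  have hcardH : Nat.card H = Nat.card H' * ℓ := by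
    have h0 := hcards 0 (Nat.zero_le μ)
    rw [Ideal.ramificationSubgroup_zero, Ideal.ramificationSubgroup_zero, hFcard] at h0
    have hH0 : 𝔓.inertia H = ⊤ := eq_top_iff.mpr fun h _ =>
      (AddSubgroup.mem_inertia (I := 𝔓.toAddSubgroup)).mpr fun z =>
        (AddSubgroup.mem_inertia (I := 𝔓.toAddSubgroup)).mp (hH h.2) z
    have hH'0 : 𝔓E.inertia H' = ⊤ := eq_top_iff.mpr fun h' _ => hH'inertia h'
    rw [hH0, hH'0, Subgroup.card_top, Subgroup.card_top] at h0
    exact h0.symm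
  have hH'pos : 0 < Nat.card H' := Nat.card_pos
  ------------------------------------------------------------------
  -- integer bookkeeping: `S_{H'}`, and `S_H(u) = m|H| ⇒ u = ψ_Λ(j)`, `S_{H'}(j) = m|H'|`
  ------------------------------------------------------------------
  have hSrel : ∀ i ≤ μ, ramificationCardSum 𝔓E H' i * ℓ = ramificationCardSum 𝔓 H i := by
    intro i hi
    rw [ramificationCardSum, ramificationCardSum, Finset.sum_mul]
    refine Finset.sum_congr rfl fun k hk => ?_
    rw [← hFcard]
    exact hcards k ((Finset.mem_Icc.mp hk).2.trans hi)
  have hbot' : 𝔓E.ramificationSubgroup H' (μ + 1) = ⊥ := hbots (μ + 1) (Nat.lt_succ_self μ)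
  have hS'add := ramificationCardSum_add_of_eq_bot 𝔓E H' hbot'
  have hSadd := ramificationCardSum_add_of_eq_bot 𝔓 H hμ1
  have hlevel : ∀ m u : ℕ, ramificationCardSum 𝔓 H u = m * Nat.card H →
      ∃ j : ℕ, u = min j μ + ℓ * (j - μ) ∧ ramificationCardSum 𝔓E H' j = m * Nat.card H' ∧
        (u ≤ μ → j = u) ∧ (μ < u → μ < j) := by
    intro m u hSu
    rcases le_or_gt u μ with hu | hu
    · refine ⟨u, by rw [min_eq_left hu, Nat.sub_eq_zero_of_le hu, mul_zero, add_zero], ?_,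
        fun _ => rfl, fun h => absurd hu (not_le.mpr h)⟩
      have h := hSrel u hu
      rw [hSu, hcardH, ← mul_assoc] at h
      exact Nat.eq_of_mul_eq_mul_right hℓpos h
    · obtain ⟨k, rfl⟩ : ∃ k, u = μ + k := ⟨u - μ, by omega⟩
      have hk : 1 ≤ k := by omega
      have h1 := hSadd k
      rw [hSu, hcardH, ← hSrel μ le_rfl] at h1
      -- `m |H'| ℓ = S'(μ) ℓ + k`, so `ℓ ∣ k`
      have hdvd : ℓ ∣ k := by
        have h2 : ℓ ∣ ramificationCardSum 𝔓E H' μ * ℓ + k := by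
          rw [← h1]; exact ⟨m * Nat.card H', by ring⟩
        exact (Nat.dvd_add_right ⟨ramificationCardSum 𝔓E H' μ, by ring⟩).mp h2
      obtain ⟨k', rfl⟩ := hdvd
      have hk' : 1 ≤ k' := by
        rcases Nat.eq_zero_or_pos k' with h | h
        · subst h; simp at hk
        · exact h
      refine ⟨μ + k', ?_, ?_, fun h => absurd h (by omega), fun _ => by omega⟩
      · rw [min_eq_right (Nat.le_add_right μ k'), Nat.add_sub_cancel_left]
      · rw [hS'add k']
        have h2 : (ramificationCardSum 𝔓E H' μ + k') * ℓ = (m * Nat.card H') * ℓ := by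
          rw [add_mul, mul_assoc, h1]; ring
        exact Nat.eq_of_mul_eq_mul_right hℓpos h2
  ------------------------------------------------------------------
  -- transfer along `ι : S_E → S` and transitivity of the norm
  ------------------------------------------------------------------
  have hdown : ∀ {z₀ : integralClosure R E} {k : ℕ},
      algebraMap (integralClosure R E) (integralClosure R L) z₀ ∈ 𝔓 ^ (ℓ * k) → z₀ ∈ 𝔓E ^ k := by
    intro z₀ k hz
    rw [← hFc] at hz
    exact mem_under_pow_of_algebraMap_mem_pow R E 𝔓 h𝔓 hF hz
  have hup : ∀ {z₀ : integralClosure R E} {k : ℕ},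
      z₀ ∈ 𝔓E ^ k → algebraMap (integralClosure R E) (integralClosure R L) z₀ ∈ 𝔓 ^ (ℓ * k) := by
    intro z₀ k hz
    rw [← hFc]
    exact algebraMap_mem_pow_of_mem_under_pow R E 𝔓 h𝔓 hF hz
  -- `N_H(1 + y) = ι (N_{H'}(w))` with `ι w = N_Λ(1 + y)`
  have htrans : ∀ y : integralClosure R L, ∃ w : integralClosure R E,
      algebraMap (integralClosure R E) (integralClosure R L) (w - 1) =
        ∏ γ : E.fixingSubgroup, (1 + (γ : L ≃ₐ[K] L) • y) - 1 ∧
      ∏ h : H, (1 + (h : L ≃ₐ[K] L) • y) = algebraMap (integralClosure R E) (integralClosure R L)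
        (∏ h' : H', (1 + (h' : E ≃ₐ[K] E) • (w - 1))) := by
    intro y
    obtain ⟨w, hw, hN⟩ := exists_prod_smul_eq_algebraMap_prod R E H hFH (1 + y)
    refine ⟨w, ?_, ?_⟩
    · rw [map_sub, map_one, hw]
      congr 1
      exact Finset.prod_congr rfl fun γ _ => by rw [smul_add, smul_one]
    · rw [Finset.prod_congr rfl fun (h : H) _ => show (1 : integralClosure R L) + (h : L ≃ₐ[K] L) • y =
        (h : L ≃ₐ[K] L) • (1 + y) by rw [smul_add, smul_one], hN]
      congr 1
      exact Finset.prod_congr rfl fun h' _ => by rw [smul_sub, smul_one, add_sub_cancel]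
  ------------------------------------------------------------------
  -- the three properties
  ------------------------------------------------------------------
  refine ⟨fun m u hSu => ?_, fun m u hSu hHu y hy hN => ?_, fun m u hSu hHu z hz hzfix => ?_⟩
  · ---------------- Prop. 8 ----------------
    obtain ⟨j, huj, hS'j, -, -⟩ := hlevel m u hSu
    refine ⟨fun y hy => ?_, fun y hy => ?_⟩
    · obtain ⟨w, hw, hN⟩ := htrans y
      rw [huj, ← hFc] at hy
      have hlayer := prod_one_add_smul_sub_one_mem_pow R E 𝔓 h𝔓 hF hFprime ht ht1 hy
      rw [hFc, ← hw] at hlayer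
      have hwE : w - 1 ∈ 𝔓E ^ j := hdown hlayer
      have hq := (hIH.level m j hS'j).1 (w - 1) hwE
      rw [hN, ← map_one (algebraMap (integralClosure R E) (integralClosure R L)), ← map_sub, hcardH,
        show m * (Nat.card H' * ℓ) = ℓ * (m * Nat.card H') by ring]
      exact hup hq
    · obtain ⟨w, hw, hN⟩ := htrans y
      rw [huj, ← hFc] at hy
      have hlayer := prod_one_add_smul_sub_one_mem_pow_succ R E 𝔓 h𝔓 hF hFprime ht ht1 hy
      rw [hFc, ← hw] at hlayer
      have hwE : w - 1 ∈ 𝔓E ^ (j + 1) := hdown hlayer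
      have hq := (hIH.level m j hS'j).2 (w - 1) hwE
      rw [hN, ← map_one (algebraMap (integralClosure R E) (integralClosure R L)), ← map_sub, hcardH,
        show (m + 1) * (Nat.card H' * ℓ) = ℓ * ((m + 1) * Nat.card H') by ring]
      exact hup hq
  · ---------------- Prop. 9, Cor. 1 (injectivity) ----------------
    obtain ⟨j, huj, hS'j, hj1, hj2⟩ := hlevel m u hSu
    -- `j ≠ μ` and `H'_j = H'_{j+1}`
    have hjμ : j ≠ μ ∧ 𝔓E.ramificationSubgroup H' j = 𝔓E.ramificationSubgroup H' (j + 1) := by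
      rcases le_or_gt u μ with hu | hu
      · have hju : j = u := hj1 hu
        subst hju
        have hne : j ≠ μ := by
          rintro rfl
          exact hHμ_ne j le_rfl (by rw [hHu, hμ1])
        have hjlt : j < μ := lt_of_le_of_ne hu hne
        refine ⟨hne, ?_⟩
        have hc1 := hcards j hu
        have hc2 := hcards (j + 1) hjlt
        rw [← hHu, ← hc1] at hc2
        have hceq : Nat.card (𝔓E.ramificationSubgroup H' (j + 1)) =
            Nat.card (𝔓E.ramificationSubgroup H' j) := Nat.eq_of_mul_eq_mul_right
          (by rw [hFcard]; exact hℓpos) hc2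
        exact (Subgroup.eq_of_le_of_card_ge (𝔓E.ramificationSubgroup_antitone H' (Nat.le_succ j))
          hceq.symm.le).symm
      · have hjμ : μ < j := hj2 hu
        exact ⟨hjμ.ne', by rw [hbots j hjμ, hbots (j + 1) (by omega)]⟩
    obtain ⟨w, hw, hN'⟩ := htrans y
    rw [huj, ← hFc] at hy
    have hlayer := prod_one_add_smul_sub_one_mem_pow R E 𝔓 h𝔓 hF hFprime ht ht1 hy
    rw [hFc, ← hw] at hlayer
    have hwE : w - 1 ∈ 𝔓E ^ j := hdown hlayer
    -- the hypothesis on `N_H(1+y)` descends to `N_{H'}(w)`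
    rw [hN', ← map_one (algebraMap (integralClosure R E) (integralClosure R L)), ← map_sub, hcardH,
      show (m + 1) * (Nat.card H' * ℓ) = ℓ * ((m + 1) * Nat.card H') by ring] at hN
    have hq : w - 1 ∈ 𝔓E ^ (j + 1) := hIH.inj m j hS'j hjμ.2 (w - 1) hwE (hdown hN)
    have hlayer' : ∏ γ : E.fixingSubgroup, (1 + (γ : L ≃ₐ[K] L) • y) - 1 ∈
        𝔓 ^ (Fintype.card E.fixingSubgroup * (j + 1)) := by
      rw [← hw, hFc]; exact hup hq
    have h := mem_pow_succ_of_prod_one_add_smul_sub_one_mem R E 𝔓 h𝔓 hF hFprime ht ht1 hjμ.1 hy hlayer'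
    rwa [hFc, ← huj] at h
  · ---------------- Prop. 9, Cor. 2 iii) (surjectivity) ----------------
    obtain ⟨j, huj, hS'j, -, hj2⟩ := hlevel m u hSu
    have hu : μ < u := by
      by_contra hle
      exact hHμ_ne u (not_lt.mp hle) hHu
    have hjμ : μ < j := hj2 hu
    have hH'j : 𝔓E.ramificationSubgroup H' j = ⊥ := hbots j hjμ
    have hj1 : 1 ≤ j := by omega
    -- `z = ι z₀` with `z₀ ∈ 𝔓_E^{m|H'|}` invariant under `H'`
    obtain ⟨z₀, rfl⟩ : ∃ z₀ : integralClosure R E,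
        algebraMap (integralClosure R E) (integralClosure R L) z₀ = z :=
      Algebra.IsInvariant.isInvariant (A := integralClosure R E) (G := E.fixingSubgroup) z
        fun γ => hzfix ⟨γ, hFH γ.2⟩
    rw [hcardH, show m * (Nat.card H' * ℓ) = ℓ * (m * Nat.card H') by ring] at hz
    have hz₀ : z₀ ∈ 𝔓E ^ (m * Nat.card H') := hdown hz
    have hz₀fix : ∀ h' : H', (h' : E ≃ₐ[K] E) • z₀ = z₀ := by
      intro h'
      obtain ⟨h, rfl⟩ := hsurjπ h'
      apply E.integralClosureInclusion_injective R
      rw [hπcoe, E.integralClosureInclusion_restrictNormalHom_smul R]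
      exact hzfix h
    obtain ⟨w₀, hw₀, hw₀N⟩ := hIH.surj m j hS'j hH'j z₀ hz₀ hz₀fix
    -- lift `w₀` through the layer
    have hιw₀fix : ∀ γ : E.fixingSubgroup, (γ : L ≃ₐ[K] L) •
        algebraMap (integralClosure R E) (integralClosure R L) w₀ =
        algebraMap (integralClosure R E) (integralClosure R L) w₀ := by
      intro γ
      have h := E.integralClosureInclusion_restrictNormalHom_smul R (γ : L ≃ₐ[K] L) w₀
      have hγ : AlgEquiv.restrictNormalHom E (γ : L ≃ₐ[K] L) = 1 := by
        rw [← MonoidHom.mem_ker, IntermediateField.restrictNormalHom_ker]; exact γ.2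
      rw [hγ, one_smul] at h
      exact h.symm
    obtain ⟨y, hy, hyN⟩ := exists_prod_one_add_smul_sub_mem_pow R E 𝔓 h𝔓 hF hFprime ht ht1 hjμ
      hιw₀fix (by rw [hFc]; exact hup hw₀)
    rw [hFc, ← huj] at hy
    refine ⟨y, hy, ?_⟩
    obtain ⟨w, hw, hN⟩ := htrans y
    rw [hFc, ← hw, ← map_sub] at hyN
    -- `w - 1 = w₀ + δ` with `δ ∈ 𝔓_E^{j+1}`
    have hδ : w - 1 - w₀ ∈ 𝔓E ^ (j + 1) := hdown hyN
    -- approximate factorisation `w ≈ (1 + w₀)(1 + c)` with `c ∈ 𝔓_E^{j+1}`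
    haveI : 𝔓E.IsMaximal := isMaximal_under_integralClosure R E 𝔓
    have hw₀𝔓 : 1 + w₀ ∉ 𝔓E := fun h => by
      have h1 : (1 : integralClosure R E) ∈ 𝔓E := by
        have := 𝔓E.sub_mem h (Ideal.pow_le_self (by omega) hw₀ : w₀ ∈ 𝔓E)
        rwa [add_sub_cancel_right] at this
      exact Ideal.IsPrime.ne_top inferInstance ((Ideal.eq_top_iff_one _).mpr h1)
    set B := (m + 1) * Nat.card H' with hB
    obtain ⟨c₀, hc₀⟩ := exists_mul_sub_one_mem_pow 𝔓E hw₀𝔓 B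
    set c := (w - 1 - w₀) * c₀ with hc
    have hcmem : c ∈ 𝔓E ^ (j + 1) := Ideal.mul_mem_right _ _ hδ
    have hε : (1 + w₀) * (1 + c) - w ∈ 𝔓E ^ B := by
      have : (1 + w₀) * (1 + c) - w = (w - 1 - w₀) * ((1 + w₀) * c₀ - 1) := by rw [hc]; ring
      rw [this]
      exact Ideal.mul_mem_left _ _ hc₀
    -- `N_{H'}(w) ≡ N_{H'}((1 + w₀)(1 + c)) = N_{H'}(1 + w₀) N_{H'}(1 + c) ≡ N_{H'}(1 + w₀) ≡ 1 + z₀`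
    have hpert : ∏ h' : H', (h' : E ≃ₐ[K] E) • ((1 + w₀) * (1 + c)) -
        ∏ h' : H', (h' : E ≃ₐ[K] E) • w ∈ 𝔓E ^ B := by
      refine prod_sub_prod_mem _ _ _ _ fun h' _ => ?_
      rw [← smul_sub]
      exact smul_mem_pow_of_smul_eq 𝔓E (hstabH' h') hε
    have hNc : ∏ h' : H', (1 + (h' : E ≃ₐ[K] E) • c) - 1 ∈ 𝔓E ^ B := (hIH.level m j hS'j).2 c hcmem
    have hmain : ∏ h' : H', (1 + (h' : E ≃ₐ[K] E) • (w - 1)) - 1 - z₀ ∈ 𝔓E ^ B := by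
      have hprodw : ∏ h' : H', (1 + (h' : E ≃ₐ[K] E) • (w - 1)) = ∏ h' : H', (h' : E ≃ₐ[K] E) • w :=
        Finset.prod_congr rfl fun h' _ => by rw [smul_sub, smul_one, add_sub_cancel]
      have hsplit : ∏ h' : H', (h' : E ≃ₐ[K] E) • ((1 + w₀) * (1 + c)) =
          (∏ h' : H', (1 + (h' : E ≃ₐ[K] E) • w₀)) * ∏ h' : H', (1 + (h' : E ≃ₐ[K] E) • c) := by
        rw [← Finset.prod_mul_distrib]
        refine Finset.prod_congr rfl fun h' _ => ?_
        rw [smul_mul', smul_add, smul_one, smul_add, smul_one]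
      have key : ∏ h' : H', (1 + (h' : E ≃ₐ[K] E) • (w - 1)) - 1 - z₀ =
          (∏ h' : H', (1 + (h' : E ≃ₐ[K] E) • w₀) - 1 - z₀) +
          (∏ h' : H', (1 + (h' : E ≃ₐ[K] E) • w₀)) * (∏ h' : H', (1 + (h' : E ≃ₐ[K] E) • c) - 1) -
          (∏ h' : H', (h' : E ≃ₐ[K] E) • ((1 + w₀) * (1 + c)) -
            ∏ h' : H', (h' : E ≃ₐ[K] E) • w) := by
        rw [hprodw, hsplit]; ring
      rw [key]
      exact Ideal.sub_mem _ (Ideal.add_mem _ hw₀N (Ideal.mul_mem_left _ _ hNc)) hpert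
    rw [hN, ← map_one (algebraMap (integralClosure R E) (integralClosure R L)), ← map_sub, ← map_sub,
      hcardH, show (m + 1) * (Nat.card H' * ℓ) = ℓ * ((m + 1) * Nat.card H') by ring]
    exact hup hmain

end Step

/-! ### Serre V §6 Props. 8–9 for cyclic totally ramified subgroups: the induction -/

section Main

universe u v w

variable {R : Type u} {K : Type v} [CommRing R] [Field K] [Algebra R K] [IsDedekindDomain R]
  [IsFractionRing R K]

attribute [local instance] integralClosureAlgebra integralClosure_isScalarTower_left
  integralClosure_isScalarTower_bot integralClosure_faithfulSMul integralClosure_isIntegral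
  integralClosure_isTorsionFree isMaximal_under_integralClosure under_integralClosure_liesOver
  residueAlgebra residueSMul isScalarTower_residue

set_option maxHeartbeats 1600000 in
/-- **Serre V §6, Props. 8–9 (with Cor. 1–2) for a cyclic subgroup of the inertia group**,
by induction on its order (auxiliary form with the order as parameter).  See `normFiltration`.
Ref: Serre, *Local Fields*, Ch. V §6, Props. 8–9 (pp. 91–92). [cite: SerreLocalFields1979, Ch. V §6 Props. 8–9] -/
theorem normFiltration_aux (n : ℕ) :
    ∀ (L : Type w) [Field L] [Algebra K L] [Algebra R L] [IsScalarTower R K L]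
      [FiniteDimensional K L] [IsGalois K L] [IsMulCommutative (L ≃ₐ[K] L)]
      (𝔓 : Ideal (integralClosure R L)) [𝔓.IsMaximal] (_ : 𝔓 ≠ ⊥)
      [Algebra.IsSeparable (R ⧸ 𝔓.under R) (integralClosure R L ⧸ 𝔓)]
      (H : Subgroup (L ≃ₐ[K] L)) [IsCyclic H] (_ : H ≤ 𝔓.inertia (L ≃ₐ[K] L)),
      Nat.card H = n → NormFiltration 𝔓 H := by
  induction n using Nat.strong_induction_on with
  | _ n ih =>
  intro L _ _ _ _ _ _ _ 𝔓 _ h𝔓 _ H _ hH hn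
  classical
  haveI : FaithfulSMul (L ≃ₐ[K] L) (integralClosure R L) := faithfulSMul_algEquiv_integralClosure R
  haveI : IsDedekindDomain (integralClosure R L) := integralClosure.isDedekindDomain R K L
  haveI h𝔓prime : 𝔓.IsPrime := Ideal.IsMaximal.isPrime inferInstance
  ------------------------------------------------------------------
  -- base case `H = 1`: `N_H(1 + y) = 1 + y`, `S_H(u) = u`
  ------------------------------------------------------------------
  by_cases hn1 : Nat.card H = 1
  · haveI : Subsingleton H := (Nat.card_eq_one_iff_unique.mp hn1).1
    have hcard1 : ∀ X : Subgroup H, Nat.card X = 1 := fun X =>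
      le_antisymm (Finite.card_le_one_iff_subsingleton.mpr inferInstance) Nat.card_pos
    have hS : ∀ u, ramificationCardSum 𝔓 H u = u := fun u => by
      rw [ramificationCardSum, Finset.sum_congr rfl fun i _ => hcard1 _, Finset.sum_const,
        Nat.card_Icc, smul_eq_mul, mul_one]
      omega
    have hprod : ∀ y : integralClosure R L,
        ∏ h : H, (1 + (h : L ≃ₐ[K] L) • y) = 1 + y := fun y => by
      rw [Fintype.prod_subsingleton _ (1 : H), OneMemClass.coe_one, one_smul]
    refine ⟨fun m u hSu => ?_, fun m u hSu _ y hy hN => ?_, fun m u hSu _ z hz _ => ?_⟩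
    · rw [hS, hn1, mul_one] at hSu
      subst hSu
      rw [hn1, mul_one, mul_one]
      exact ⟨fun y hy => by rw [hprod, add_sub_cancel_left]; exact hy,
        fun y hy => by rw [hprod, add_sub_cancel_left]; exact hy⟩
    · rw [hS, hn1, mul_one] at hSu
      subst hSu
      rw [hn1, mul_one, hprod, add_sub_cancel_left] at hN
      exact hN
    · rw [hS, hn1, mul_one] at hSu
      subst hSu
      rw [hn1, mul_one] at hz ⊢
      exact ⟨z, hz, by rw [hprod, add_sub_cancel_left, sub_self]; exact Submodule.zero_mem _⟩
  ------------------------------------------------------------------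
  -- the last jump `μ`, and a subgroup `Λ ≤ H_μ` of prime order `ℓ`
  ------------------------------------------------------------------
  haveI : FaithfulSMul H (integralClosure R L) :=
    ⟨fun {a b} h => Subtype.ext (FaithfulSMul.eq_of_smul_eq_smul
      (M := L ≃ₐ[K] L) (α := integralClosure R L) fun z => h z)⟩
  have hH0 : 𝔓.ramificationSubgroup H 0 = ⊤ := by
    refine eq_top_iff.mpr fun h _ => ?_
    rw [Ideal.ramificationSubgroup_zero]
    exact (AddSubgroup.mem_inertia (I := 𝔓.toAddSubgroup)).mpr fun z =>
      (AddSubgroup.mem_inertia (I := 𝔓.toAddSubgroup)).mp (hH h.2) z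
  obtain ⟨μ, hμ, hμ1⟩ := exists_last_jump 𝔓 H (Ideal.IsMaximal.ne_top inferInstance) hH0 hn1
  obtain ⟨ℓ, g, hℓ, hgcard⟩ := exists_prime_card_zpowers (A := 𝔓.ramificationSubgroup H μ)
    (fun h1 => hμ (Subgroup.card_eq_one.mp h1))
  set γ₀ : L ≃ₐ[K] L := (((g : 𝔓.ramificationSubgroup H μ) : H) : L ≃ₐ[K] L) with hγ₀
  set Λ : Subgroup (L ≃ₐ[K] L) := Subgroup.zpowers γ₀ with hΛ
  have hΛcard : Nat.card Λ = ℓ := by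
    rw [hΛ, Nat.card_zpowers, hγ₀, Subgroup.orderOf_coe, Subgroup.orderOf_coe, ← Nat.card_zpowers]
    exact hgcard
  have hΛH : Λ ≤ H := by
    rw [hΛ, Subgroup.zpowers_le]
    exact ((g : 𝔓.ramificationSubgroup H μ) : H).2
  have hΛμ : ∀ γ ∈ Λ, γ ∈ 𝔓.ramificationSubgroup (L ≃ₐ[K] L) μ := by
    rw [hΛ, ← SetLike.le_def, Subgroup.zpowers_le]
    exact (mem_ramificationSubgroup_subgroup_iff 𝔓 H).mp g.2
  ------------------------------------------------------------------
  -- the Galois subextension `E = L^Λ` and the quotient data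
  ------------------------------------------------------------------
  haveI : Λ.Normal := Subgroup.normal_of_isMulCommutative Λ
  obtain ⟨E, hEΛ⟩ : ∃ E : IntermediateField K L, E.fixingSubgroup = Λ :=
    ⟨IntermediateField.fixedField Λ, IntermediateField.fixingSubgroup_fixedField Λ⟩
  haveI : E.fixingSubgroup.Normal := by rw [hEΛ]; infer_instance
  haveI : IsGalois K E := by
    have h := IsGalois.of_fixedField_normal_subgroup E.fixingSubgroup
    rwa [IsGalois.fixedField_fixingSubgroup] at h
  haveI : IsMulCommutative (E ≃ₐ[K] E) :=
    isMulCommutative_of_surjective _ (AlgEquiv.restrictNormalHom_surjective L)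
  haveI : IsDedekindDomain (integralClosure R E) := integralClosure.isDedekindDomain R K E
  haveI : Algebra.IsIntegral (integralClosure R E) (integralClosure R L) :=
    integralClosure_isIntegral R E
  haveI : (𝔓.comap (E.integralClosureInclusion R)).IsMaximal := isMaximal_under_integralClosure R E 𝔓
  have h𝔓E0 : 𝔓.comap (E.integralClosureInclusion R) ≠ ⊥ := Ideal.IsIntegral.comap_ne_bot _ h𝔓
  haveI : Algebra.IsSeparable (R ⧸ (𝔓.comap (E.integralClosureInclusion R)).under R)
      (integralClosure R E ⧸ 𝔓.comap (E.integralClosureInclusion R)) :=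
    isSeparable_residue_bot R E 𝔓
  haveI : IsCyclic (H.map (AlgEquiv.restrictNormalHom E)) :=
    isCyclic_of_surjective _ ((AlgEquiv.restrictNormalHom E).subgroupMap_surjective H)
  have hFH : E.fixingSubgroup ≤ H := hEΛ ▸ hΛH
  have hFcard : Nat.card E.fixingSubgroup = ℓ := by rw [hEΛ, hΛcard]
  have hFμ : ∀ γ ∈ E.fixingSubgroup, γ ∈ 𝔓.ramificationSubgroup (L ≃ₐ[K] L) μ := by
    rw [hEΛ]; exact hΛμ
  have hH' : H.map (AlgEquiv.restrictNormalHom E) ≤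
      (𝔓.comap (E.integralClosureInclusion R)).inertia (E ≃ₐ[K] E) := by
    rintro _ ⟨h, hh, rfl⟩
    refine (AddSubgroup.mem_inertia (I := (𝔓.comap (E.integralClosureInclusion R)).toAddSubgroup)).mpr
      fun z => ?_
    change E.integralClosureInclusion R (AlgEquiv.restrictNormalHom E h • z - z) ∈ 𝔓
    rw [map_sub, E.integralClosureInclusion_restrictNormalHom_smul R]
    exact (AddSubgroup.mem_inertia (I := 𝔓.toAddSubgroup)).mp (hH hh) _
  -- `|H'| ℓ = |H|`, so `|H'| < n`
  obtain ⟨hcards, -⟩ :=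
    card_ramificationSubgroup_map_restrictNormalHom R E 𝔓 h𝔓 H hH hFH (μ := μ) hFμ hμ1
  have hcardH : Nat.card (H.map (AlgEquiv.restrictNormalHom E)) * ℓ = Nat.card H := by
    have h0 := hcards 0 (Nat.zero_le μ)
    rw [hFcard] at h0
    have hH'0 : (𝔓.comap (E.integralClosureInclusion R)).ramificationSubgroup
        (H.map (AlgEquiv.restrictNormalHom E)) 0 = ⊤ := by
      rw [Ideal.ramificationSubgroup_zero]
      exact eq_top_iff.mpr fun h' _ =>
        (AddSubgroup.mem_inertia (I := (𝔓.comap (E.integralClosureInclusion R)).toAddSubgroup)).mpr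
          fun z => (AddSubgroup.mem_inertia
            (I := (𝔓.comap (E.integralClosureInclusion R)).toAddSubgroup)).mp (hH' h'.2) z
    rw [hH0, hH'0, Subgroup.card_top, Subgroup.card_top] at h0
    exact h0
  have hlt : Nat.card (H.map (AlgEquiv.restrictNormalHom E)) < n := by
    rw [← hn, ← hcardH]
    have hpos : 0 < Nat.card (H.map (AlgEquiv.restrictNormalHom E)) := Nat.card_pos
    nlinarith [hℓ.two_le]
  have hIH := ih _ hlt E (𝔓.comap (E.integralClosureInclusion R)) h𝔓E0
    (H.map (AlgEquiv.restrictNormalHom E)) hH' rfl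
  exact normFiltration_step R E 𝔓 h𝔓 H hH hFH hℓ hFcard hFμ hμ1 hIH

/-- **Serre V §6, Props. 8–9 and Cor. 1–2 (completion-free, integer form) for a cyclic subgroup
of the inertia group of an abelian extension.**  For `R` Dedekind with fraction field `K`,
`L/K` finite abelian, `𝔓 ≠ 0` a maximal ideal of `S_L` with separable residue extension, and a
cyclic `H ≤ T_𝔓`: the norm `N_H` satisfies `level`, `inj`, `surj` of
`Literature.….NormFiltration` (`N(U^{ψ(m)}) ⊆ U^m`, `N(U^{ψ(m)+1}) ⊆ U^{m+1}`; injectivity of the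
graded norm `N_m` when `H_{ψ(m)} = H_{ψ(m)+1}`; graded surjectivity when `H_{ψ(m)} = 1`).
Proof: `normFiltration_aux` (induction on `|H|` by dévissage through a layer of prime degree).
Ref: Serre, *Local Fields*, Ch. V §6, Props. 8, 9, Cor. 1, Cor. 2 iii) (pp. 91–92).
[cite: SerreLocalFields1979, Ch. V §6 Props. 8–9] -/
theorem normFiltration {L : Type w} [Field L] [Algebra K L] [Algebra R L] [IsScalarTower R K L]
    [FiniteDimensional K L] [IsGalois K L] [IsMulCommutative (L ≃ₐ[K] L)]
    (𝔓 : Ideal (integralClosure R L)) [𝔓.IsMaximal] (h𝔓 : 𝔓 ≠ ⊥)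
    [Algebra.IsSeparable (R ⧸ 𝔓.under R) (integralClosure R L ⧸ 𝔓)]
    (H : Subgroup (L ≃ₐ[K] L)) [IsCyclic H] (hH : H ≤ 𝔓.inertia (L ≃ₐ[K] L)) :
    NormFiltration 𝔓 H :=
  normFiltration_aux (R := R) (K := K) (Nat.card H) L 𝔓 h𝔓 H hH rfl

end Main

end Literature.NumberTheory.GaloisRepresentations

end
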